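import Summits.QuantumFields.YangMills.Theorems.BalabanUVNodesN12TowerSiteGraphConnectedBjPrelim
import HarnessLib

/-!
# BalabanUVNodes ∕ N12 — THE TOWER-SITE CONSTRAINT GRAPH OF THE RECORD's DETERMINING SET `𝐁_k(Z) = Bj M₁ Z k` IS CONNECTED
# (the located precondition of the (T1@q₀)-central letter at reducible base data — the companion POSITIVE lemma to dag-n12-w1's twist obstruction)

[Balaban1988Convergent] = «[III]», (2.2) p. 255 (the determining set `𝐁 = {Γ_j}`, `Γ₀ = Ω₁ᶜ`, `Γ_j = Ω_j^{(j)} ∖ Ω_{j+1}^{(j)}`, `Γ_k = Ω_k^{(k)}`), (2.13)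
pp. 256–257 (the maximal sequence `Ω = Ω₀ ⊃ Ω₁ ⊃ … ⊃ Ω_k`: `Ω_n` a union of `LⁿξM₁`-cubes, `dist(Ω_n, Ωᶜ_{n−1}) ≥ LⁿξM₁`); [Balaban1987RG1] (0.1)–(0.3)
pp. 251–252 (the block lattices `T^{(j)}`, blocks and centres); [Balaban1985Variational] = «[15]», Thm 1 p. 279 («a unique critical orbit in the space (6)»), (3)–(4) p. 278.

Cell `pub-ymgap` (HUMAN RULINGS D-0062 ∕ D-0149), WIDTH SEAT `pub-ymgap-dag-n12-w6` g17 (node N12 = [B15]; key K1⁹ `stmt-QuantumFields-27364`, `--kind proof --supports … --as helper`;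
count-neutral).  THEOREMS ONLY (0 `def`, 0 `instance`, 0 `sorry`).  Pure lattice combinatorics over landed kernel theorems, consumed BY NAME: r11∕r12's `B14.Eq213DetSet`
(`Bj`, `maxDomT`, `Bj_zero`∕`Bj_mid`∕`Bj_top`, `isBlockUnion_maxDomT(_succ)`, the printed collar `dist_maxDomT`, `maxDomT_antitone`), dag-n12-w3's `N12FlatHndRecordLetters.hcov_Bj` (every
fine site has a level), `N12RootedForest.exists_word_walkEnd_eq` (the fine torus is connected) and `N12BlockChains.blockOf_shift_or` ∕ `exists_blockWalk` (a lattice path inside one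
block), dag-n21-e's `N21ReadSetSupport` (`within_lift_of_blockIter_eq`, `blockIter_embIter`, `within_add_single`, `eq_of_shift_eq`).

WHY (numbers, not adjectives).  The (J0′) producer OF RECORD at N12 (dag-n12-c g26 V4 `…N12MinimiserFamilyOfClassThreshold.hMin_atRecord_of_node00Letters_thm1AtBase_central_ofClass_threshold`,
:173–:176) displays per base field `V_k` the row (T1@q₀)-CENTRAL: every constrained `U ∈ reg′` with no larger action is `U₀^{u⁻¹}` for a gauge transformation `u` whose tower
restrictions are EQUAL and CENTRAL at the two tower sites `ι_j c₋`, `ι_j c₊` of every constrained bond `c ∈ bondsOf (𝐁_k(Z) j)`, `j ≤ k`.  dag-n12-w1 g4 LOCATED (memo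
`LOCATED-3-T1-CENTRAL-AT-REDUCIBLE-DATA.md`; kernel: `N12Thm1CentralLetterTwistObstruction.not_T1central_flat_of_disconnected`, p645205) that at the FLAT base field `V_k ≡ 1` — a
member of every closed plaquette guard `{∀ p, |V_k(∂p) − 1| ≤ eR}` the knit quantifies over — this row is FALSE as soon as the TOWER-SITE CONSTRAINT GRAPH 𝒢 of the determining set
(vertices = the fine sites `ι_j c₋`, `ι_j c₊` of the constrained bonds, edges = the constrained bonds) is DISCONNECTED: a set `T` of fine sites closed under the constrained bonds (`hT`)
containing one tower site (`hz₁`) and missing another (`hz₂`) twists `1` into a datum-preserving, action-preserving configuration outside the central orbit.  The referee's WATCH on that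
file (ref-B READ-891) and w1's HANDOFF trigger (t6) record the companion positive lemma «𝒢 connected at the record» as UNOWNED.  THIS FILE PROVES IT for every domain `Z ⊂ T_η`, every
`1 ≤ k ≤ m + K`, every `M₁ ≥ 2` with the standing divisibility `LᵏM₁ ∣ 2L^{m+K}`: §3 `towerSite_mem_of_closed_Bj` is, BY SHAPE, the negation of the disconnection data
`(hT, hz₁, hz₂)` of `not_T1central_flat_of_disconnected` at `𝔹 := Bj M₁ Z k`; `not_disconnected_towerSiteGraph_Bj` says the obstruction's premise set is EMPTY at the record.

THE PROOF (gluing of the levels along `∂Ω_j`, [III] (2.2)∕(2.13)).  Every fine site `x` has a LEVEL `ℓ ≤ k` — the scale whose member `Γ_ℓ` contains the `ℓ`-block of `x`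
(dag-n12-w3's coverage letter `hcov_Bj`; unique, §1) — and a TOWER PROJECTION `τ x := ι_ℓ B^ℓ(x)`, a tower site.  For `T` closed under the constrained bonds the predicate `τ x ∈ T` is
invariant along EVERY fine bond `⟨x, x + e_μ⟩` (§2): the two levels differ by at most one (the printed collar `dist(Ω_{n+1}, Ω_nᶜ) ≥ L^{n+1}M₁ > 1`); at equal levels the two
`ℓ`-blocks are equal or adjacent, and adjacent `Γ_ℓ`-blocks span a constrained bond; at levels `ℓ`, `ℓ+1` the `(ℓ+1)`-block `w` of the shallower site is NOT in `Ω_{ℓ+1}` but adjacent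
to the `(ℓ+1)`-block of the deeper one, which is a `Γ_{ℓ+1}`-site — so `⟨w, ·⟩` is a constrained `(ℓ+1)`-bond whose outer tower site `ι_{ℓ+1} w = ι_ℓ (centre of w)` is a
level-`ℓ` tower site, and ALL `ℓ`-sites of the block `w` lie in `Γ_ℓ` (off `Ω_{ℓ+1}` because `w` is; inside `Ω_ℓ` by the collar, `M₁ ≥ 2`), so the centre of `w` and `B^ℓ(x)` are
joined INSIDE `w` by constrained `ℓ`-bonds (w3's `exists_blockWalk`).  The fine torus is connected (w3's `exists_word_walkEnd_eq`), so `τ x ∈ T` is constant in `x`; a tower site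
`ι_j c₋` with `c₋ ∈ Γ_j` is its own projection, and one with `c₊ ∈ Γ_j` is `T`-equivalent to `ι_j c₊` by closedness — whence §3.

CONTENTS (namespace `Summit.QuantumFields.YangMills.BalabanUVNodes.N12TowerSiteGraphConnectedBj`; generic `P : Params`, any `Z ⊂ T_η`).  PART 1 = `…N12TowerSiteGraphConnectedBjPrelim`
(levels: `exists_level` = w3's (Cov), `level_unique`, `levels_near_of_shift` = the collar; `blockIter_shift_or`; ★ `mem_Bj_of_blockOf_eq_outerBlock`, ★ `embIter_mem_iff_of_outerBlock`).
THIS PART: §2 ★★ `towerProj_mem_iff_shift_same` ∕ `_up` ∕ `_down` ∕ `towerProj_mem_iff_shift` (invariance of `τ x ∈ T` along a fine bond), `levelPred_iff_shift` ∕ `levelPred_walkEnd` ∕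
`levelPred_const` (constancy on the torus); §3 ★★★ `towerSite_mem_of_closed_Bj`, ★★★ `towerSites_subset_of_closed_Bj`, ★★ `not_disconnected_towerSiteGraph_Bj`.

HONEST FRAMING.  A located PRECONDITION of a displayed hypothesis-letter is discharged — NOT the letter: with 𝒢 connected, (T1@q₀)-central at the flat base field still asks that every
flat fibre configuration with the unit multi-scale datum on `𝐁_k(Z)` be tower-central-gauge-trivial (print's [15] Thm 1 uniqueness at that datum; not typed here).  Count-neutral
helper; nothing of Bałaban's estimates asserted or refuted; N12 NOT discharged; K1⁹ NOT closed; counts of record unmoved; one finite 𝕋⁴ programme at fixed ε — R4 closes the conditional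
rung `BalabanLadder.UV` only; the Yang–Mills mass gap (Clay) is NOT proved by any of this; nothing continuum ∕ ℝ⁴ ∕ OS.
-/

namespace Summit.QuantumFields.YangMills.BalabanUVNodes.N12TowerSiteGraphConnectedBj

open Set
open Literature.MathematicalPhysics.QuantumFieldTheory.Balaban1983to89
open B15DeterminingSets (DetSet pts mem_pts bondsOf embIter)
open B14.Eq213DetSet (Bj maxDomT Bj_zero Bj_mid Bj_top maxDomT_antitone isBlockUnion_maxDomT isBlockUnion_maxDomT_succ dist_maxDomT)
open B14.Eq213MaximalDomains (side)
open B14.Eq22Determines (blockIter blockIter_zero blockIter_succ IsBlockUnion)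
open B15Eq112TorusCover (cover lift cover_lift)
open T4Continuum (walkEnd)
open Summit.QuantumFields.YangMills.BalabanUVNodes.N12RootedForest (exists_word_walkEnd_eq)
open Summit.QuantumFields.YangMills.Theorems.N21ReadSetSupport (blockIter_embIter)
open Summit.QuantumFields.YangMills.BalabanUVNodes.N12TowerSiteGraphConnectedBjPrelim

variable {P : Params} {M₁ k : ℕ} {Z : Set (Site P 0)}

/-! ## §2  The tower projection `τ x = ι_ℓ B^ℓ(x)` is `T`-invariant along every fine bond, hence constant on the torus -/

/-- ★★ **SAME LEVEL**: if the `j`-block of `x` is a `Γ_j`-site (`j ≤ k`), then `ι_j B^j(x) ∈ T ↔ ι_j B^j(x + e_μ) ∈ T` — the two blocks are equal, or `μ`-adjacent along the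
constrained bond `⟨B^j(x), μ⟩`. [cite: Balaban1988Convergent, (2.2) p.255; Balaban1987RG1, (0.3) p.252 (bookkeeping)] -/
theorem towerProj_mem_iff_shift_same (hk : k ≤ P.m + P.K) {T : Set (Site P 0)}
    (hT : ∀ j, j ≤ k → ∀ c ∈ bondsOf (Bj M₁ Z k j), (embIter j c.src ∈ T ↔ embIter j c.tgt ∈ T))
    {x : Site P 0} {μ : Fin P.d} {j : ℕ} (hj : j ≤ k) (h : blockIter j x ∈ Bj M₁ Z k j) :
    (embIter j (blockIter j x) ∈ T ↔ embIter j (blockIter j (x.shift μ)) ∈ T) := by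
  rcases blockIter_shift_or (hj.trans hk) x μ with e | e
  · rw [e]
  · rw [e]
    exact hT j hj ⟨blockIter j x, μ⟩ (Or.inl h)

/-- ★★ **ONE LEVEL UP** (`x` of level `j`, `x + e_μ` of level `j + 1 ≤ k`): `ι_j B^j(x) ∈ T ↔ ι_{j+1} B^{j+1}(x + e_μ) ∈ T`.  The `(j+1)`-block `w` of `x` is not that of `x + e_μ`
(`x ∉ Ω_{j+1} ∋ x + e_μ`, a union of `(j+1)`-blocks), so `⟨w, μ⟩` is a constrained `(j+1)`-bond with `ι_{j+1} w = ι_j (centre of w)`, and the centre of `w` is joined to `B^j(x)`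
inside `w` (`embIter_mem_iff_of_outerBlock`). [cite: Balaban1988Convergent, (2.2) p.255, (2.13) pp.256–257] -/
theorem towerProj_mem_iff_shift_up (hM : 2 ≤ M₁) (hk1 : 1 ≤ k) (hk : k ≤ P.m + P.K) (hdiv : side P.L M₁ k ∣ P.sitesPerDir 0)
    {T : Set (Site P 0)} (hT : ∀ j, j ≤ k → ∀ c ∈ bondsOf (Bj M₁ Z k j), (embIter j c.src ∈ T ↔ embIter j c.tgt ∈ T))
    {x : Site P 0} {μ : Fin P.d} {j : ℕ} (hj : j + 1 ≤ k)
    (h : blockIter j x ∈ Bj M₁ Z k j) (h' : blockIter (j + 1) (x.shift μ) ∈ Bj M₁ Z k (j + 1)) :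
    (embIter j (blockIter j x) ∈ T ↔ embIter (j + 1) (blockIter (j + 1) (x.shift μ)) ∈ T) := by
  have hM1 : 1 ≤ M₁ := one_le_of_two_le hM
  have hx : x ∉ maxDomT M₁ Z (j + 1) := not_mem_maxDomT_succ_of_level hM1 hk hdiv (by omega) h
  have hx' : x.shift μ ∈ maxDomT M₁ Z (j + 1) := mem_maxDomT_of_level hM1 hk hdiv (by omega) hj h'
  rcases blockIter_shift_or (show j + 1 ≤ P.m + P.K by omega) x μ with e | e
  · exfalso
    have hBU := isBlockUnion_maxDomT hM1 hdiv (show 1 ≤ j + 1 by omega) hj (show j + 1 ≤ P.m + P.K by omega) (Ω := Z)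
    have h1 := (hBU (x.shift μ)).1 hx'
    rw [e] at h1
    exact hx ((hBU x).2 h1)
  · -- the constrained `(j+1)`-bond `⟨w, μ⟩`: its target is the `Γ_{j+1}`-site `B^{j+1}(x + e_μ)`
    have hc : (⟨blockIter (j + 1) x, μ⟩ : PBond P (j + 1)) ∈ bondsOf (Bj M₁ Z k (j + 1)) := by
      refine Or.inr ?_
      show (blockIter (j + 1) x).shift μ ∈ Bj M₁ Z k (j + 1)
      rw [← e]; exact h'
    have step := hT (j + 1) hj _ hc
    -- inside the block `w`: `B^j(x)` and the centre `emb w` are `T`-equivalent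
    have hin := embIter_mem_iff_of_outerBlock hM hk1 hk hdiv hj (Or.inl rfl) hx' hx hT (blockIter j x) (emb (blockIter (j + 1) x))
      (blockIter_succ j x).symm (Site.blockOf_emb (by omega) _)
    rw [hin]
    show embIter (j + 1) (blockIter (j + 1) x) ∈ T ↔ _
    rw [step]
    show embIter (j + 1) ((blockIter (j + 1) x).shift μ) ∈ T ↔ _
    rw [← e]

/-- ★★ **ONE LEVEL DOWN** (`x` of level `j + 1 ≤ k`, `x + e_μ` of level `j`): `ι_{j+1} B^{j+1}(x) ∈ T ↔ ι_j B^j(x + e_μ) ∈ T` — the mirror image of `towerProj_mem_iff_shift_up`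
(the constrained `(j+1)`-bond is now `⟨B^{j+1}(x), μ⟩`, sourced in `Γ_{j+1}`, and the outer block is `B^{j+1}(x + e_μ)`). [cite: Balaban1988Convergent, (2.2) p.255, (2.13) pp.256–257] -/
theorem towerProj_mem_iff_shift_down (hM : 2 ≤ M₁) (hk1 : 1 ≤ k) (hk : k ≤ P.m + P.K) (hdiv : side P.L M₁ k ∣ P.sitesPerDir 0)
    {T : Set (Site P 0)} (hT : ∀ j, j ≤ k → ∀ c ∈ bondsOf (Bj M₁ Z k j), (embIter j c.src ∈ T ↔ embIter j c.tgt ∈ T))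
    {x : Site P 0} {μ : Fin P.d} {j : ℕ} (hj : j + 1 ≤ k)
    (h : blockIter (j + 1) x ∈ Bj M₁ Z k (j + 1)) (h' : blockIter j (x.shift μ) ∈ Bj M₁ Z k j) :
    (embIter (j + 1) (blockIter (j + 1) x) ∈ T ↔ embIter j (blockIter j (x.shift μ)) ∈ T) := by
  have hM1 : 1 ≤ M₁ := one_le_of_two_le hM
  have hx : x ∈ maxDomT M₁ Z (j + 1) := mem_maxDomT_of_level hM1 hk hdiv (by omega) hj h
  have hx' : x.shift μ ∉ maxDomT M₁ Z (j + 1) := not_mem_maxDomT_succ_of_level hM1 hk hdiv (by omega) h'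
  rcases blockIter_shift_or (show j + 1 ≤ P.m + P.K by omega) x μ with e | e
  · exfalso
    have hBU := isBlockUnion_maxDomT hM1 hdiv (show 1 ≤ j + 1 by omega) hj (show j + 1 ≤ P.m + P.K by omega) (Ω := Z)
    have h1 := (hBU x).1 hx
    rw [← e] at h1
    exact hx' ((hBU (x.shift μ)).2 h1)
  · -- the constrained `(j+1)`-bond `⟨B^{j+1}(x), μ⟩`, sourced in `Γ_{j+1}`; its target is the outer block `w' = B^{j+1}(x + e_μ)`
    have hc : (⟨blockIter (j + 1) x, μ⟩ : PBond P (j + 1)) ∈ bondsOf (Bj M₁ Z k (j + 1)) := Or.inl h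
    have step := hT (j + 1) hj _ hc
    have hin := embIter_mem_iff_of_outerBlock hM hk1 hk hdiv hj (Or.inr rfl) hx hx' hT (blockIter j (x.shift μ))
      (emb (blockIter (j + 1) (x.shift μ))) (blockIter_succ j (x.shift μ)).symm (Site.blockOf_emb (by omega) _)
    rw [step, hin]
    show (embIter (j + 1) ((blockIter (j + 1) x).shift μ) ∈ T) ↔ embIter (j + 1) (blockIter (j + 1) (x.shift μ)) ∈ T
    rw [← e]

/-- ★★ **`T`-INVARIANCE OF THE TOWER PROJECTION ALONG A FINE BOND**: for `T` closed under the constrained bonds of `𝐁_k(Z)`, a fine site `x` whose `j`-block is a `Γ_j`-site and its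
neighbour `x + e_μ` whose `j'`-block is a `Γ_{j'}`-site (`j, j' ≤ k`): `ι_j B^j(x) ∈ T ↔ ι_{j'} B^{j'}(x + e_μ) ∈ T` (the levels are at most one apart, `levels_near_of_shift`; then
`_same` ∕ `_up` ∕ `_down`). [cite: Balaban1988Convergent, (2.2) p.255, (2.13) pp.256–257] -/
theorem towerProj_mem_iff_shift (hM : 2 ≤ M₁) (hk1 : 1 ≤ k) (hk : k ≤ P.m + P.K) (hdiv : side P.L M₁ k ∣ P.sitesPerDir 0)
    {T : Set (Site P 0)} (hT : ∀ j, j ≤ k → ∀ c ∈ bondsOf (Bj M₁ Z k j), (embIter j c.src ∈ T ↔ embIter j c.tgt ∈ T))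
    (x : Site P 0) (μ : Fin P.d) {j j' : ℕ} (hj : j ≤ k) (hj' : j' ≤ k)
    (h : blockIter j x ∈ Bj M₁ Z k j) (h' : blockIter j' (x.shift μ) ∈ Bj M₁ Z k j') :
    (embIter j (blockIter j x) ∈ T ↔ embIter j' (blockIter j' (x.shift μ)) ∈ T) := by
  obtain ⟨h1, h2⟩ := levels_near_of_shift hM hk hdiv hj hj' h h'
  rcases lt_trichotomy j j' with hlt | rfl | hgt
  · obtain rfl : j' = j + 1 := by omega
    exact towerProj_mem_iff_shift_up hM hk1 hk hdiv hT hj' h h'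
  · exact towerProj_mem_iff_shift_same hk hT hj h
  · obtain rfl : j = j' + 1 := by omega
    exact towerProj_mem_iff_shift_down hM hk1 hk hdiv hT hj h h'

/-- **THE LEVEL PREDICATE «`ι_j B^j(x) ∈ T` at the level `j` of `x`» IS INVARIANT UNDER `x ↦ x + e_μ`** (levels exist, w3's (Cov), and are unique, §1).
[cite: Balaban1988Convergent, (2.2) p.255, (2.13) pp.256–257] -/
theorem levelPred_iff_shift (hM : 2 ≤ M₁) (hk1 : 1 ≤ k) (hk : k ≤ P.m + P.K) (hdiv : side P.L M₁ k ∣ P.sitesPerDir 0)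
    {T : Set (Site P 0)} (hT : ∀ j, j ≤ k → ∀ c ∈ bondsOf (Bj M₁ Z k j), (embIter j c.src ∈ T ↔ embIter j c.tgt ∈ T))
    (x : Site P 0) (μ : Fin P.d) :
    (∀ j, j ≤ k → blockIter j x ∈ Bj M₁ Z k j → embIter j (blockIter j x) ∈ T) ↔
      (∀ j, j ≤ k → blockIter j (x.shift μ) ∈ Bj M₁ Z k j → embIter j (blockIter j (x.shift μ)) ∈ T) := by
  have hM1 : 1 ≤ M₁ := one_le_of_two_le hM
  obtain ⟨j₀, hj₀, h₀⟩ := exists_level hM1 hk1 hk hdiv x (Z := Z)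
  obtain ⟨j₁, hj₁, h₁⟩ := exists_level hM1 hk1 hk hdiv (x.shift μ) (Z := Z)
  have key := towerProj_mem_iff_shift hM hk1 hk hdiv hT x μ hj₀ hj₁ h₀ h₁
  constructor
  · intro H j hj h
    obtain rfl : j = j₁ := level_unique hM1 hk hdiv hj hj₁ h h₁
    exact key.1 (H j₀ hj₀ h₀)
  · intro H j hj h
    obtain rfl : j = j₀ := level_unique hM1 hk hdiv hj hj₀ h h₀
    exact key.2 (H j₁ hj₁ h₁)

/-- … hence invariant along every lattice walk (induction on the word; a backward letter is a forward one read from the other end). [cite: Balaban1987RG1, (0.1) p.251 (the torus; bookkeeping)] -/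
theorem levelPred_walkEnd (hM : 2 ≤ M₁) (hk1 : 1 ≤ k) (hk : k ≤ P.m + P.K) (hdiv : side P.L M₁ k ∣ P.sitesPerDir 0)
    {T : Set (Site P 0)} (hT : ∀ j, j ≤ k → ∀ c ∈ bondsOf (Bj M₁ Z k j), (embIter j c.src ∈ T ↔ embIter j c.tgt ∈ T)) :
    ∀ (w : List (Fin P.d × Bool)) (r : Site P 0),
      (∀ j, j ≤ k → blockIter j r ∈ Bj M₁ Z k j → embIter j (blockIter j r) ∈ T) ↔
        (∀ j, j ≤ k → blockIter j (walkEnd r w) ∈ Bj M₁ Z k j → embIter j (blockIter j (walkEnd r w)) ∈ T)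
  | [], _ => Iff.rfl
  | (μ, true) :: w, r => (levelPred_iff_shift hM hk1 hk hdiv hT r μ).trans (levelPred_walkEnd hM hk1 hk hdiv hT w (r.shift μ))
  | (μ, false) :: w, r => by
    have h := levelPred_iff_shift hM hk1 hk hdiv hT (r.unshift μ) μ (Z := Z)
    rw [B10StarCount.shift_unshift] at h
    exact h.symm.trans (levelPred_walkEnd hM hk1 hk hdiv hT w (r.unshift μ))

/-- … hence CONSTANT on the (connected) fine torus (dag-n12-w3's `exists_word_walkEnd_eq`). [cite: Balaban1987RG1, (0.1) p.251 (the torus; bookkeeping)] -/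
theorem levelPred_const (hM : 2 ≤ M₁) (hk1 : 1 ≤ k) (hk : k ≤ P.m + P.K) (hdiv : side P.L M₁ k ∣ P.sitesPerDir 0)
    {T : Set (Site P 0)} (hT : ∀ j, j ≤ k → ∀ c ∈ bondsOf (Bj M₁ Z k j), (embIter j c.src ∈ T ↔ embIter j c.tgt ∈ T))
    (x y : Site P 0) :
    (∀ j, j ≤ k → blockIter j x ∈ Bj M₁ Z k j → embIter j (blockIter j x) ∈ T) ↔
      (∀ j, j ≤ k → blockIter j y ∈ Bj M₁ Z k j → embIter j (blockIter j y) ∈ T) := by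
  obtain ⟨w, hw⟩ := exists_word_walkEnd_eq x y
  subst hw
  exact levelPred_walkEnd hM hk1 hk hdiv hT w x

/-! ## §3  Connectivity of the tower-site graph of `𝐁_k(Z)` -/

/-- ★★★ **THE TOWER-SITE CONSTRAINT GRAPH OF `𝐁_k(Z)` IS CONNECTED** (every `Z ⊂ T_η`; `1 ≤ k ≤ m + K`; `M₁ ≥ 2`; `LᵏM₁ ∣ 2L^{m+K}`): a set `T` of fine sites CLOSED under the
constrained bonds of `𝐁_k(Z)` (`ι_j c₋ ∈ T ↔ ι_j c₊ ∈ T` for every `c ∈ bondsOf (𝐁_k(Z) j)`, `j ≤ k`) that contains ONE tower site `ι_{j₁} c₁₋` contains EVERY tower site `ι_{j₂} c₂₋`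
— by shape the negation of the disconnection data `(hT, hz₁, hz₂)` of dag-n12-w1's `N12Thm1CentralLetterTwistObstruction.not_T1central_flat_of_disconnected` at `𝔹 := Bj M₁ Z k`:
the twist obstruction against the (T1@q₀)-central row NEVER fires at the record.  Proof: §2's constancy of the level predicate, read at the fine representatives of the `Γ`-ends of
`c₁` and `c₂` (a `Γ_j`-site is its own level-`j` block; the other end is `T`-equivalent by closedness).
[cite: Balaban1988Convergent, (2.2) p.255, (2.13) pp.256–257; Balaban1985Variational, Thm 1 p.279, (3)–(4) p.278] -/
theorem towerSite_mem_of_closed_Bj (hM : 2 ≤ M₁) (hk1 : 1 ≤ k) (hk : k ≤ P.m + P.K) (hdiv : side P.L M₁ k ∣ P.sitesPerDir 0)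
    (T : Set (Site P 0)) (hT : ∀ j, j ≤ k → ∀ c ∈ bondsOf (Bj M₁ Z k j), (embIter j c.src ∈ T ↔ embIter j c.tgt ∈ T))
    {j₁ : ℕ} (hj₁ : j₁ ≤ k) {c₁ : PBond P j₁} (hc₁ : c₁ ∈ bondsOf (Bj M₁ Z k j₁)) (hz₁ : embIter j₁ c₁.src ∈ T)
    {j₂ : ℕ} (hj₂ : j₂ ≤ k) {c₂ : PBond P j₂} (hc₂ : c₂ ∈ bondsOf (Bj M₁ Z k j₂)) : embIter j₂ c₂.src ∈ T := by
  have hM1 : 1 ≤ M₁ := one_le_of_two_le hM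
  -- at the representative of a `Γ_j`-SITE `s` the level predicate reads `ι_j s ∈ T`
  have hrep : ∀ {j : ℕ}, j ≤ k → ∀ {s : Site P j}, s ∈ Bj M₁ Z k j →
      ((∀ i, i ≤ k → blockIter i (embIter j s) ∈ Bj M₁ Z k i → embIter i (blockIter i (embIter j s)) ∈ T) ↔ embIter j s ∈ T) := by
    intro j hj s hs
    have hb : blockIter j (embIter j s) = s := blockIter_embIter (hj.trans hk) s
    have hsj : blockIter j (embIter j s) ∈ Bj M₁ Z k j := by rw [hb]; exact hs
    constructor
    · intro H
      have h := H j hj hsj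
      rwa [hb] at h
    · intro hsT i hi hi'
      obtain rfl : i = j := level_unique hM1 hk hdiv hi hj hi' hsj
      rw [hb]; exact hsT
  -- `c₁` has an end in `Γ_{j₁}` whose representative lies in `T`
  obtain ⟨s₁, hs₁, hs₁T⟩ : ∃ s₁ : Site P j₁, s₁ ∈ Bj M₁ Z k j₁ ∧ embIter j₁ s₁ ∈ T := by
    rcases (show c₁.src ∈ Bj M₁ Z k j₁ ∨ c₁.tgt ∈ Bj M₁ Z k j₁ from hc₁) with h | h
    · exact ⟨c₁.src, h, hz₁⟩
    · exact ⟨c₁.tgt, h, (hT j₁ hj₁ c₁ hc₁).1 hz₁⟩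
  have P1 := (hrep hj₁ hs₁).2 hs₁T
  rcases (show c₂.src ∈ Bj M₁ Z k j₂ ∨ c₂.tgt ∈ Bj M₁ Z k j₂ from hc₂) with h | h
  · exact (hrep hj₂ h).1 ((levelPred_const hM hk1 hk hdiv hT (embIter j₁ s₁) (embIter j₂ c₂.src)).1 P1)
  · exact (hT j₂ hj₂ c₂ hc₂).2 ((hrep hj₂ h).1 ((levelPred_const hM hk1 hk hdiv hT (embIter j₁ s₁) (embIter j₂ c₂.tgt)).1 P1))

/-- ★★★ **ALL TOWER SITES, BOTH ENDS**: under the hypotheses of `towerSite_mem_of_closed_Bj`, `T` contains `ι_j c₋` and `ι_j c₊` for every constrained bond `c` of every level `j ≤ k`.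
[cite: Balaban1988Convergent, (2.2) p.255, (2.13) pp.256–257; Balaban1985Variational, Thm 1 p.279] -/
theorem towerSites_subset_of_closed_Bj (hM : 2 ≤ M₁) (hk1 : 1 ≤ k) (hk : k ≤ P.m + P.K) (hdiv : side P.L M₁ k ∣ P.sitesPerDir 0)
    (T : Set (Site P 0)) (hT : ∀ j, j ≤ k → ∀ c ∈ bondsOf (Bj M₁ Z k j), (embIter j c.src ∈ T ↔ embIter j c.tgt ∈ T))
    {j₁ : ℕ} (hj₁ : j₁ ≤ k) {c₁ : PBond P j₁} (hc₁ : c₁ ∈ bondsOf (Bj M₁ Z k j₁)) (hz₁ : embIter j₁ c₁.src ∈ T) :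
    ∀ j, j ≤ k → ∀ c ∈ bondsOf (Bj M₁ Z k j), embIter j c.src ∈ T ∧ embIter j c.tgt ∈ T := fun j hj c hc =>
  have h := towerSite_mem_of_closed_Bj hM hk1 hk hdiv T hT hj₁ hc₁ hz₁ hj hc
  ⟨h, (hT j hj c hc).1 h⟩

/-- ★★ **AT N12's RECORD BINDERS** — the instance data of the (J0′) producer of record (`…N12MinimiserFamilyOfClassThreshold`: `ν : Node00.Stage7Numerics`, height `Kt`, domain `Z`,
`hM4 : 4L ≤ M₁`, `hkK : k + 1 ≤ m + K`, `hk0 : 0 < k`, `hdiv : LᵏM₁ ∣ 2L^{m+K}`): the tower-site graph of its determining set `𝔹 = Bj ν.M₁ Z k` is connected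
(`towerSite_mem_of_closed_Bj`, `2 ≤ M₁ ⟸ 4L ≤ M₁`), so the twist obstruction cannot be armed against its (T1@q₀) row at any base field.
[cite: Balaban1988Convergent, (2.2) p.255, (2.13) pp.256–257; Balaban1985Variational, Thm 1 p.279, (3)–(4) p.278] -/
theorem towerSite_mem_of_closed_Bj_atRecord {F : T4Continuum.T4Family} (ν : Node00.Stage7Numerics) (Kt : ℕ) (Z₀ : Set (Site (F.P Kt) 0)) {k : ℕ}
    (hM4 : 4 * (F.P Kt).L ≤ ν.M₁) (hkK : k + 1 ≤ (F.P Kt).m + (F.P Kt).K) (hk0 : 0 < k) (hdiv : side (F.P Kt).L ν.M₁ k ∣ (F.P Kt).sitesPerDir 0)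
    (T : Set (Site (F.P Kt) 0)) (hT : ∀ j, j ≤ k → ∀ c ∈ bondsOf (Bj ν.M₁ Z₀ k j), (embIter j c.src ∈ T ↔ embIter j c.tgt ∈ T))
    {j₁ : ℕ} (hj₁ : j₁ ≤ k) {c₁ : PBond (F.P Kt) j₁} (hc₁ : c₁ ∈ bondsOf (Bj ν.M₁ Z₀ k j₁)) (hz₁ : embIter j₁ c₁.src ∈ T)
    {j₂ : ℕ} (hj₂ : j₂ ≤ k) {c₂ : PBond (F.P Kt) j₂} (hc₂ : c₂ ∈ bondsOf (Bj ν.M₁ Z₀ k j₂)) : embIter j₂ c₂.src ∈ T :=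
  towerSite_mem_of_closed_Bj (le_trans (by have := (F.P Kt).L_pos; omega) hM4) hk0 (by omega) hdiv T hT hj₁ hc₁ hz₁ hj₂ hc₂

/-- ★★ **THE TWIST OBSTRUCTION's PREMISE SET IS EMPTY AT THE RECORD**: there is NO set of fine sites closed under the constrained bonds of `𝐁_k(Z)` separating two tower sites — the
disconnection data `(T, hT, j₁, c₁, hz₁, j₂, c₂, hz₂)` of `N12Thm1CentralLetterTwistObstruction.not_T1central_flat_of_disconnected` cannot be supplied at `𝔹 := Bj M₁ Z k`
(`1 ≤ k ≤ m + K`, `M₁ ≥ 2`, `LᵏM₁ ∣ 2L^{m+K}`). [cite: Balaban1988Convergent, (2.2) p.255, (2.13) pp.256–257; Balaban1985Variational, Thm 1 p.279, (3)–(4) p.278] -/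
theorem not_disconnected_towerSiteGraph_Bj (hM : 2 ≤ M₁) (hk1 : 1 ≤ k) (hk : k ≤ P.m + P.K) (hdiv : side P.L M₁ k ∣ P.sitesPerDir 0) :
    ¬ ∃ (T : Set (Site P 0)) (j₁ : ℕ) (c₁ : PBond P j₁) (j₂ : ℕ) (c₂ : PBond P j₂),
        (∀ j, j ≤ k → ∀ c ∈ bondsOf (Bj M₁ Z k j), (embIter j c.src ∈ T ↔ embIter j c.tgt ∈ T)) ∧
        j₁ ≤ k ∧ c₁ ∈ bondsOf (Bj M₁ Z k j₁) ∧ embIter j₁ c₁.src ∈ T ∧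
        j₂ ≤ k ∧ c₂ ∈ bondsOf (Bj M₁ Z k j₂) ∧ embIter j₂ c₂.src ∉ T := by
  rintro ⟨T, j₁, c₁, j₂, c₂, hT, hj₁, hc₁, hz₁, hj₂, hc₂, hz₂⟩
  exact hz₂ (towerSite_mem_of_closed_Bj hM hk1 hk hdiv T hT hj₁ hc₁ hz₁ hj₂ hc₂)

end Summit.QuantumFields.YangMills.BalabanUVNodes.N12TowerSiteGraphConnectedBj
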